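import Literature.NumberTheory.Kottwitz1992.VirtualAbelianVarieties
import Literature.AlgebraicGeometry.Motives.AbelianVarietyEndAlgebraInstances
import Literature.AlgebraicGeometry.Motives.FaltingsAbelianOfFinitenessIProofs
import Literature.NumberTheory.ComplexMultiplication.CMAlgebraTorusSimpleSubalgebraRosatiStable
import HarnessLib

/-!
# [Kottwitz1992, Lemma 10.2 pp. 404–405] `End_{𝒱_r}(A)`, the centralizer of the semisimple Frobenius `π_A` in `End⁰(Ā)`,
# is a semisimple `ℚ`-algebra — DISCHARGED: `Kottwitz1992_10_2_endAlg_isSemisimpleRing_holds`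

Kernel-lane companion of the statement carpet ★ `Literature/NumberTheory/Kottwitz1992/VirtualAbelianVarieties.lean` (squad TK,
HCML «GO 500»): the named fact ★ `VirtualAbelianVarieties.Kottwitz1992_10_2_endAlg_isSemisimpleRing` — «Let `A` be a
`c`-polarizable virtual abelian variety over `k_r` up to isogeny […].  Then `π := π_A` is a semisimple element of `End(A)`.
Moreover the `ℚ`-algebra `End(A)` is semisimple», typed as: for `A ∈ 𝒱_{r,c}` (`InVc c`, whose first conjunct is the
semisimplicity of `π_A`, i.e. a separable minimal polynomial) the centralizer `End_{𝒱_r}(A) = Z_{End⁰(Ā)}(π_A)` is a semisimple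
ring — is PROVED here.  THEOREMS ONLY (no definition, no named fact, no `sorry`, no instance, no notation); cell hodgecm-mathlib,
seat B-typ02 (g32); net debt −1.

R. E. Kottwitz, *Points on some Shimura varieties over finite fields*, J. Amer. Math. Soc. 5 (1992) 373–444, Lemma 10.2
pp. 404–405 (held `paper:doi-10-2307-2152772`, p0032 L49 – p0033 L9).  THE PRINTED PROOF of the second statement (p. 405
L7–L9): «The second statement of the lemma follows from the first, since `End(A)` is the centralizer of `π` in the semisimple
algebra `End(Ā)`.»

THE PROOF FOLLOWED.  Exactly the print, with its two tacit inputs supplied by the tree and by §1: (a) «the semisimple algebra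
`End(Ā)`» — `End⁰(Ā) = ℚ ⊗ End(Ā)` is semisimple by Poincaré's complete reducibility theorem, the tree's ★
`AbelianVariety.isSemisimpleRing_endAlgebra_of_perfectField` (`k = 𝔽̄_p` is algebraically closed, hence perfect), and
finite-dimensional over `ℚ` (★ `endAlgebra.instModuleFinite`, Mumford §19 Thm. 3); (b) «the centralizer of [a semisimple] `π`
in [a] semisimple algebra» is semisimple — §1 `isSemisimpleRing_centralizer_of_separable`: `Z_E(π) = Z_E(ℚ[π])`, and for the
reduced commutative finite-dimensional `ℚ[π]` (separable minimal polynomial) the ring `R = Eᵐᵒᵖ ⊗_ℚ ℚ[π]` is semisimple (the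
tree's ★ `ComplexMultiplication.isSemisimpleRing_tensorProduct_of_comm_isReduced`, Pierce §10.7), `E` is a finite `R`-module
(`(e ⊗ l) · x = l x e`) and `Z_E(ℚ[π]) ≅ End_R(E)` (`c ↦ (x ↦ c x)`, inverse `φ ↦ φ(1)`), the endomorphism ring of a finite
semisimple module being semisimple (Mathlib `IsSemisimpleRing.moduleEnd`).  The first statement of the lemma (semisimplicity of
`π_A` from a `c`-polarization via the compactness of `{x | λ(x)x = 1}`) is the HYPOTHESIS `InVc` of the typed fact (see the
carpet's dictionary) and is not re-proved.
HONEST LABEL: HC_CM is proved only modulo the 7 printed citations (2 remaining: hLiu418, h413) until rung 0 closes; this file adds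
no citation debt (0 facts, 0 sorry) and discharges 1 named fact of ★ `VirtualAbelianVarieties`; it is off the HC_CM cone.

## What is proved
* §1 (namespace `…VirtualAbelianVarieties.Lemma102`; private folklore `isReduced_adjoin`)
  **`isSemisimpleRing_centralizer_of_separable`** — the centralizer of an element with separable minimal polynomial in a
  finite-dimensional semisimple `ℚ`-algebra is semisimple.
* **`Kottwitz1992_10_2_endAlg_isSemisimpleRing_holds`** — the named fact.

## References
* [Kottwitz1992] R. E. Kottwitz, Points on some Shimura varieties over finite fields, J. Amer. Math. Soc. 5 (1992) 373–444,
  §10 Lemma 10.2 (pp. 404–405).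
* [MumfordAV1970] D. Mumford, Abelian Varieties (1970), §19 Cor. 2 of Thm. 1 (through the tree's
  `Motives/AbelianVarietyEndAlgebraSemisimple`, `Motives/FaltingsAbelianOfFinitenessIProofs`).
-/

open Polynomial
open scoped TensorProduct

namespace Literature.NumberTheory.Kottwitz1992.VirtualAbelianVarieties

namespace Lemma102

/-! ## §1 The centralizer of an element with separable minimal polynomial in a finite-dimensional semisimple
`ℚ`-algebra is semisimple -/

section Centralizer

variable {E : Type*} [Ring E] [Algebra ℚ E]

/-- `ℚ[π]` is reduced when the minimal polynomial of `π` is separable (`ℚ[π] ≅ ℚ[T]/(f)`, `f` square-free).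
[folklore] -/
private theorem isReduced_adjoin {π : E} (hsep : (minpoly ℚ π).Separable) : IsReduced (Algebra.adjoin ℚ {π}) := by
  refine ⟨fun y ⟨n, hn⟩ => ?_⟩
  rcases Nat.eq_zero_or_pos n with rfl | hn0
  · rw [pow_zero] at hn
    exact Subsingleton.elim (h := subsingleton_of_zero_eq_one hn.symm) _ _
  obtain ⟨q, hq⟩ : ∃ q : ℚ[X], aeval π q = (y : E) :=
    (AlgHom.mem_range _).mp ((Algebra.adjoin_singleton_eq_range_aeval ℚ π).le y.2)
  have hdvd : minpoly ℚ π ∣ q ^ n := minpoly.dvd ℚ π (by rw [map_pow, hq, ← Subalgebra.coe_pow, hn, Subalgebra.coe_zero])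
  apply Subtype.ext
  rw [Subalgebra.coe_zero, ← hq]
  obtain ⟨r, hr⟩ := (hsep.squarefree.dvd_pow_iff_dvd hn0.ne').mp hdvd
  rw [hr, map_mul, minpoly.aeval, zero_mul]

open scoped IsMulCommutative in
/-- **The centralizer of a semisimple element of a finite-dimensional semisimple `ℚ`-algebra is semisimple** («`End(A)`
is the centralizer of `π` in the semisimple algebra `End(Ā)`», p. 405): for `E` finite-dimensional semisimple over `ℚ`
and `π ∈ E` with separable minimal polynomial, `Z_E(π) = Z_E(ℚ[π])` is the endomorphism ring of `E` as a module over the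
semisimple ring `Eᵐᵒᵖ ⊗_ℚ ℚ[π]` (★ `ComplexMultiplication.isSemisimpleRing_tensorProduct_of_comm_isReduced`: `ℚ[π]` is
commutative reduced), hence semisimple. [cite: Kottwitz1992, §10 Lemma 10.2 (proof, p. 405)] -/
theorem isSemisimpleRing_centralizer_of_separable [Module.Finite ℚ E] [IsSemisimpleRing E] {π : E}
    (hsep : (minpoly ℚ π).Separable) : IsSemisimpleRing (Subalgebra.centralizer ℚ ({π} : Set E)) := by
  classical
  have hint : IsIntegral ℚ π := by
    by_contra h
    exact hsep.ne_zero (minpoly.eq_zero h)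
  -- `L = ℚ[π]`, a finite-dimensional reduced commutative `ℚ`-algebra
  set L : Subalgebra ℚ E := Algebra.adjoin ℚ {π} with hL
  haveI : IsMulCommutative L := by rw [hL]; exact Algebra.isMulCommutative_adjoin_singleton ℚ π
  haveI : Module.Finite ℚ L := by rw [hL]; exact Module.Finite.iff_fg.mpr hint.fg_adjoin_singleton
  haveI : IsReduced L := by rw [hL]; exact isReduced_adjoin hsep
  -- `E` as a module over `R = Eᵐᵒᵖ ⊗_ℚ L`
  haveI : SMulCommClass Eᵐᵒᵖ L E := SMulCommClass.symm _ _ _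
  letI : Module (Eᵐᵒᵖ ⊗[ℚ] L) E := TensorProduct.Algebra.module
  have hsmul : ∀ (e : Eᵐᵒᵖ) (l : L) (x : E), (e ⊗ₜ[ℚ] l) • x = (l : E) * x * e.unop := fun e l x => by
    rw [TensorProduct.Algebra.smul_def, MulOpposite.smul_eq_mul_unop, Subalgebra.smul_def, smul_eq_mul]
  haveI : IsScalarTower ℚ (Eᵐᵒᵖ ⊗[ℚ] L) E := by
    refine ⟨fun q t x => ?_⟩
    induction t using TensorProduct.induction_on with
    | zero => rw [smul_zero, zero_smul (Eᵐᵒᵖ ⊗[ℚ] L) x, smul_zero]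
    | tmul e l => rw [TensorProduct.smul_tmul', TensorProduct.Algebra.smul_def, TensorProduct.Algebra.smul_def, smul_assoc]
    | add t t' ht ht' => rw [smul_add, add_smul, add_smul, ht, ht', smul_add]
  haveI : IsSemisimpleRing (Eᵐᵒᵖ ⊗[ℚ] L) :=
    ComplexMultiplication.isSemisimpleRing_tensorProduct_of_comm_isReduced ℚ Eᵐᵒᵖ L
  haveI : Module.Finite (Eᵐᵒᵖ ⊗[ℚ] L) E := Module.Finite.of_restrictScalars_finite ℚ _ E
  haveI : IsSemisimpleRing (Module.End (Eᵐᵒᵖ ⊗[ℚ] L) E) := IsSemisimpleRing.moduleEnd _ E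
  -- elements of the centralizer commute with `L`
  have hcomm : ∀ c ∈ Subalgebra.centralizer ℚ ({π} : Set E), ∀ l : L, c * (l : E) = l * c := fun c hc l =>
    Subalgebra.mem_centralizer_iff ℚ |>.mp (Algebra.adjoin_le_centralizer_centralizer ℚ {π} l.2) c hc
  -- the ring isomorphism `Z_E(π) ≃ End_R(E)`, `c ↦ (x ↦ c x)`
  let Φ : Subalgebra.centralizer ℚ ({π} : Set E) →+* Module.End (Eᵐᵒᵖ ⊗[ℚ] L) E :=
    { toFun := fun c =>
        { toFun := fun x => (c : E) * x
          map_add' := fun x y => mul_add _ _ _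
          map_smul' := fun t x => by
            simp only [RingHom.id_apply]
            induction t using TensorProduct.induction_on with
            | zero => rw [zero_smul (Eᵐᵒᵖ ⊗[ℚ] L) x, zero_smul (Eᵐᵒᵖ ⊗[ℚ] L) ((c : E) * x), mul_zero]
            | tmul e l => rw [hsmul, hsmul, ← mul_assoc, ← mul_assoc, hcomm c c.2 l, mul_assoc (l : E) (c : E) x]
            | add t t' ht ht' => rw [add_smul, mul_add, ht, ht', add_smul] }
      map_one' := LinearMap.ext fun x => one_mul x
      map_mul' := fun c c' => LinearMap.ext fun x => mul_assoc _ _ _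
      map_zero' := LinearMap.ext fun x => zero_mul x
      map_add' := fun c c' => LinearMap.ext fun x => add_mul _ _ _ }
  have hΦ : ∀ c x, Φ c x = (c : E) * x := fun c x => rfl
  refine (RingEquiv.ofBijective Φ ⟨fun c c' h => ?_, fun φ => ?_⟩).symm.isSemisimpleRing
  · apply Subtype.ext
    have := congrArg (fun ψ => ψ (1 : E)) h
    simpa [hΦ] using this
  · -- `φ` is left multiplication by `φ 1`, which centralizes `π`
    have hφ : ∀ x : E, φ x = φ 1 * x := fun x => by
      have := φ.map_smul (MulOpposite.op x ⊗ₜ[ℚ] (1 : L)) 1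
      rw [hsmul, hsmul, MulOpposite.unop_op, Subalgebra.coe_one, one_mul, one_mul, one_mul] at this
      exact this
    have hπ : π * φ 1 = φ 1 * π := by
      have := φ.map_smul ((1 : Eᵐᵒᵖ) ⊗ₜ[ℚ] (⟨π, Algebra.self_mem_adjoin_singleton ℚ π⟩ : L)) 1
      rw [hsmul, hsmul, MulOpposite.unop_one, mul_one, mul_one, mul_one] at this
      rw [← this, hφ π]
    refine ⟨⟨φ 1, Subalgebra.mem_centralizer_iff ℚ |>.mpr fun g hg => ?_⟩, LinearMap.ext fun x => ?_⟩
    · rw [Set.mem_singleton_iff] at hg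
      rw [hg, hπ]
    · rw [hΦ, ← hφ]

end Centralizer

end Lemma102

open Lemma102 in
/-- **KOTTWITZ 1992, LEMMA 10.2 (second clause), PROVED**: ★ `Kottwitz1992_10_2_endAlg_isSemisimpleRing` holds — for
`A ∈ 𝒱_{r,c}` (so `π_A` has separable minimal polynomial) the `ℚ`-algebra `End_{𝒱_r}(A)`, the centralizer of `π_A` in
`End⁰(Ā)`, is semisimple: «`End(A)` is the centralizer of `π` in the semisimple algebra `End(Ā)`» — `End⁰(Ā)` is
semisimple by Poincaré complete reducibility (the tree's ★ `AbelianVariety.isSemisimpleRing_endAlgebra_of_perfectField`,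
`k` algebraically closed) and finite-dimensional (★ `endAlgebra.instModuleFinite`), and the centralizer of a semisimple
element of a finite-dimensional semisimple `ℚ`-algebra is semisimple (`Lemma102.isSemisimpleRing_centralizer_of_separable`).
[cite: Kottwitz1992, §10 Lemma 10.2 (pp. 404–405)] -/
theorem Kottwitz1992_10_2_endAlg_isSemisimpleRing_holds : Kottwitz1992_10_2_endAlg_isSemisimpleRing := by
  intro k _ _ p _ _ _ _ r _ X c _ hX
  haveI : IsSemisimpleRing X.A.endAlgebra :=
    Literature.AlgebraicGeometry.Motives.AbelianVariety.isSemisimpleRing_endAlgebra_of_perfectField X.A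
  exact isSemisimpleRing_centralizer_of_separable hX.1

end Literature.NumberTheory.Kottwitz1992.VirtualAbelianVarieties
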